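import Mathlib
import HarnessLib
import Summits.HubbardSuperconductivity.HubbardSuperconductivity.Theorems.KLProgrammeKLRegimeEngineFrameShiftReadingDoorFlow
import Summits.HubbardSuperconductivity.HubbardSuperconductivity.Theorems.KLProgrammeKLRegimeEngineLegPairFourierMoments

/-!
# K3 gen-8-FLOW (stmt 20437 `KLRegimeEngineV17F2`, stub (C)): DOOR (B) ON THE FLOW FRAMES WITH ITS KERNEL INPUTS `N, S` IN POSITION SPACE —
# the pinned, spatially weighted `L¹` norms of the trivial-multiplier two- and four-leg position kernels of the interpolated one-shot action

Cell gate-hubbard-kl, seat p2 g12.  Door (B) (`…EngineFrameShiftMomentDoorFlow.moment_selfEnergy_flowStep_sub_le`, p545976) and its reading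
(`…EngineFrameShiftReadingDoorFlow.norm_iteratedFDeriv_evalM_symInterp_flowStep_response_le`, p547378) take the kernel inputs `N`, `S` as MOMENTS of
the inverse spatial Fourier transform of MOMENTUM-space data.  The engine's two-leg / four-leg export currency is the position-space one (the
trivial-multiplier kernels `sectorisedKernel β 1 G m Ω`, pinned at leg `0`, weight on the torus difference `x⃗₁ − x⃗₀`; KL STATUS 2026-08-27 16:32:40Z
«DUAL CONFIRMED», class-#7 atom `TwoLegMomentsAt`).  With the leg-pair Fourier bridge (`…EngineLegPairFourierMoments`, this seat) the two doors are
re-issued with `N`, `S` replaced by position-space bounds `Nₚ`, `Sₚ`: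

* **`moment_selfEnergy_flowStep_sub_le_of_position`** — door (B) on the flow frames with
  `hSp : ε_x Σ_{x : x 0 = x₀} (1+|Δx̃₀|+|Δx̃₁|)ʳ ‖W₂[𝒢_t]((σ,+),(σ,−))(x)‖ ≤ Sₚ` and
  `hNp : ε_x³ Σ_{x : x 0 = x₀} (1+|Δx̃₀|+|Δx̃₁|)ʳ ‖W₄[𝒢_t]((σ,+),(σ,−),(τ,1−c),(τ,c))(x)‖ ≤ Nₚ` (every `t ∈ [0,1]`, `x₀`, `τ`, `c`;
  `𝒢_t = effAction (C₀ + t(C₁ − C₀)) V_U`), conclusion as in p545976 with `N := Nₚ/(βL²)³`, `S := Sₚ/(βL²)`;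
* **`norm_iteratedFDeriv_evalM_symInterp_flowStep_response_le_of_position`** — the reading (p547378) with the same substitution; the position
  bounds do not see the reading frequency, so they are asked per spin only.

Proofs only; `Nₚ`, `Sₚ` are hypotheses (the (b)-F tower's pinned norms along the interpolation — registrant); nothing about their sizes is asserted;
nothing asserts superconductivity.  References: Salmhofer 1998 §3.1; BGM 2006 §2.1 (2.5), §2.3 (2.17), §3 (3.2)–(3.8)
[cite: BenfattoGiulianiMastropietro2006].
-/

noncomputable section

namespace Summit.HubbardSuperconductivity.HubbardSuperconductivity.Theorems.EngineV8

set_option linter.dupNamespace false -- summit = problem name (single-conjunct summit), D-0017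

open Finset Literature.MathematicalPhysics.QuantumLattice Literature.Probability.LatticeModels GrassmannAlgebra Set
open Summit.HubbardSuperconductivity.HubbardSuperconductivity.Theorems.KLRegimeSplit
open Summit.HubbardSuperconductivity.HubbardSuperconductivity.Theorems.TwoLegFourier
open scoped Nat

variable {L M : ℕ} [NeZero L] [NeZero M]

/-- **DOOR (B) ON THE FLOW FRAMES, KERNEL INPUTS IN POSITION SPACE**: the position moments of order `r` of the frame-shift response of the two-leg
kernel between `K_n` and `K_{n+1}` at the reading frequency `ω_i`, from the pinned `(1+|Δx̃₀|+|Δx̃₁|)ʳ`-weighted `L¹` norms `Sₚ` (two legs) and `Nₚ`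
(four legs, every spin/charge of the fixed pair) of the trivial-multiplier position kernels of the interpolated one-shot action. -/
theorem moment_selfEnergy_flowStep_sub_le_of_position {B₁ : ℝ} (hB' : ∀ y, |deriv salmhoferCutoff y| ≤ B₁) {β : ℝ} (hβ : 0 < β) {Λ : ℝ}
    (hΛ : 0 < Λ) (μ U : ℝ) (n : ℕ) {s₀ s₁ : FreqMomentum L M × Fin 2 → ℂ} (hs₀ : s₀ = uvSymbolCT L M β μ (klFlowFrameU L M β U μ n) Λ)
    (hs₁ : s₁ = uvSymbolCT L M β μ (klFlowFrameU L M β U μ (n + 1)) Λ) (i : MatsubaraIdx M) (σ : Fin 2) (r : ℕ)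
    (hZ : ∀ t ∈ Set.Icc (0 : ℝ) 1, effPartitionFn ℂ (normalCovariance L M s₀ + ((t : ℂ)) • (normalCovariance L M s₁ - normalCovariance L M s₀))
      (hubbardInteraction L M β U) ≠ 0)
    {Np Sp : ℝ}
    (hNp : ∀ t ∈ Set.Icc (0 : ℝ) 1, ∀ (τ c : Fin 2) (x₀ : SpaceTimeIdx L M), imagTimeWeight β M ^ 3 *
      ∑ x ∈ (univ : Finset (Fin 4 → SpaceTimeIdx L M)).filter (fun x => x 0 = x₀),
        (1 + ((((x 1).2 - (x 0).2) 0).valMinAbs.natAbs : ℝ) + ((((x 1).2 - (x 0).2) 1).valMinAbs.natAbs : ℝ)) ^ r *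
          ‖sectorisedKernel L M β (trivialMultiplier L M)
              (effAction ℂ (normalCovariance L M s₀ + ((t : ℂ)) • (normalCovariance L M s₁ - normalCovariance L M s₀))
                (hubbardInteraction L M β U)) 4
              (![((0, σ), 0), ((0, σ), 1), ((0, τ), 1 - c), ((0, τ), c)] : Fin 4 → SectorLeg 1) x‖ ≤ Np)
    (hSp : ∀ t ∈ Set.Icc (0 : ℝ) 1, ∀ x₀ : SpaceTimeIdx L M, imagTimeWeight β M *
      ∑ x ∈ (univ : Finset (Fin 2 → SpaceTimeIdx L M)).filter (fun x => x 0 = x₀),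
        (1 + ((((x 1).2 - (x 0).2) 0).valMinAbs.natAbs : ℝ) + ((((x 1).2 - (x 0).2) 1).valMinAbs.natAbs : ℝ)) ^ r *
          ‖sectorisedKernel L M β (trivialMultiplier L M)
              (effAction ℂ (normalCovariance L M s₀ + ((t : ℂ)) • (normalCovariance L M s₁ - normalCovariance L M s₀))
                (hubbardInteraction L M β U)) 2
              (![((0, σ), 0), ((0, σ), 1)] : Fin 2 → SectorLeg 1) x‖ ≤ Sp)
    {N' : ℕ} {B : ℝ} (hB1 : 1 ≤ B) (hB : ∀ l ≤ N', ∀ t, ‖iteratedDeriv l salmhoferCutoff t‖ ≤ B) (hN' : r + 4 ≤ N')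
    {pj : ℕ → ℕ → ℝ} (hpj : ∀ m ≤ n, ∀ j ≤ r + 2, ∀ q : Momentum, ‖iteratedFDeriv ℝ j (evalM (klFlowPiece L M β U μ m)) q‖ ≤ pj m j)
    {d : ℝ} (hfit : ∀ j, 1 ≤ j → j ≤ r + 2 → 4 + ∑ m ∈ range n, pj m j + pj n j ≤ d * (6 / max |matsubaraFreq β M i| (Λ / 2)) ^ (j - 1))
    {J : ℝ}
    (hJ : ∀ k ≤ r + 2, (Real.pi / 2) ^ k * ∑ j ∈ Finset.range (k + 1), (k.choose j : ℝ) *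
      (j ! * ((2 * (β * (L : ℝ) ^ 2) * B * (2 / max |matsubaraFreq β M i| (Λ / 2)) ^ 2) * j !) *
        (max d 1 * (6 / max |matsubaraFreq β M i| (Λ / 2))) ^ j) * pj n (k - j) ≤ J) :
    ∑ x : TorusSite 2 L, (1 + ((x 0).valMinAbs.natAbs : ℝ) + ((x 1).valMinAbs.natAbs : ℝ)) ^ r * ‖torusFourierInv (fun kv : TorusSite 2 L =>
        selfEnergy L M β (effAction ℂ (normalCovariance L M s₁) (hubbardInteraction L M β U)) (i, kv) σ -
          selfEnergy L M β (effAction ℂ (normalCovariance L M s₀) (hubbardInteraction L M β U)) (i, kv) σ) x‖ ≤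
      2 * (|β| * (L : ℝ) ^ 2) *
        (12 * (2 * (L : ℝ) ^ 2 * ((2 * B₁ + 1) * (β * (L : ℝ) ^ 2)) * (2 * β / Λ) *
            frameDist (klFlowFrameU L M β U μ (n + 1)) (klFlowFrameU L M β U μ n)) * (Np / (β * (L : ℝ) ^ 2) ^ 3) +
          2 * (21 * 3 ^ r * J) * (Sp / (β * (L : ℝ) ^ 2)) ^ 2) := by
  have hw0 : ∀ z : TorusSite 2 L, 0 ≤ (1 + ((z 0).valMinAbs.natAbs : ℝ) + ((z 1).valMinAbs.natAbs : ℝ)) ^ r := fun z => by positivity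
  refine moment_selfEnergy_flowStep_sub_le hB' hβ hΛ μ U n hs₀ hs₁ i σ r hZ (N := Np / (β * (L : ℝ) ^ 2) ^ 3)
    (S := Sp / (β * (L : ℝ) ^ 2)) (fun t ht A => ?_) (fun t ht => ?_) hB1 hB hN' hpj hfit hJ
  · exact sum_weight_mul_norm_torusFourierInv_kernel_four_le hβ _ i σ A hw0 (hNp t ht A.1.2 A.2)
  · exact sum_weight_mul_norm_torusFourierInv_kernel_two_le hβ _ i σ hw0 (hSp t ht)

/-- **DOOR (B) READ ON THE FLOW FRAMES, KERNEL INPUTS IN POSITION SPACE**: the momentum jets of order `j` of the interpolated, spin/frequency-averaged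
real part of the two-leg RESPONSE between `K_n` and `K_{n+1}`, from the position-space bounds `Nₚ`, `Sₚ` (asked per spin; they do not see the
reading frequency).  The piece-table fit `hfit` and the table `hJ` are asked ONLY at the two reading indices `ip`, `im` (p547378 asks them at every
Matsubara index, which is more than its proof uses; at `±ω₀` both read `m_ω = max(π/β, Λ/2)`). -/
theorem norm_iteratedFDeriv_evalM_symInterp_flowStep_response_le_of_position {B₁ : ℝ} (hB' : ∀ y, |deriv salmhoferCutoff y| ≤ B₁) {β : ℝ}
    (hβ : 0 < β) {Λ : ℝ} (hΛ : 0 < Λ) (μ U : ℝ) (n : ℕ) {s₀ s₁ : FreqMomentum L M × Fin 2 → ℂ}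
    (hs₀ : s₀ = uvSymbolCT L M β μ (klFlowFrameU L M β U μ n) Λ) (hs₁ : s₁ = uvSymbolCT L M β μ (klFlowFrameU L M β U μ (n + 1)) Λ)
    (ip im : MatsubaraIdx M) (j : ℕ)
    (hZ : ∀ t ∈ Set.Icc (0 : ℝ) 1, effPartitionFn ℂ (normalCovariance L M s₀ + ((t : ℂ)) • (normalCovariance L M s₁ - normalCovariance L M s₀))
      (hubbardInteraction L M β U) ≠ 0)
    {Np Sp : ℝ}
    (hNp : ∀ (σ τ c : Fin 2), ∀ t ∈ Set.Icc (0 : ℝ) 1, ∀ x₀ : SpaceTimeIdx L M, imagTimeWeight β M ^ 3 *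
      ∑ x ∈ (univ : Finset (Fin 4 → SpaceTimeIdx L M)).filter (fun x => x 0 = x₀),
        (1 + ((((x 1).2 - (x 0).2) 0).valMinAbs.natAbs : ℝ) + ((((x 1).2 - (x 0).2) 1).valMinAbs.natAbs : ℝ)) ^ j *
          ‖sectorisedKernel L M β (trivialMultiplier L M)
              (effAction ℂ (normalCovariance L M s₀ + ((t : ℂ)) • (normalCovariance L M s₁ - normalCovariance L M s₀))
                (hubbardInteraction L M β U)) 4
              (![((0, σ), 0), ((0, σ), 1), ((0, τ), 1 - c), ((0, τ), c)] : Fin 4 → SectorLeg 1) x‖ ≤ Np)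
    (hSp : ∀ (σ : Fin 2), ∀ t ∈ Set.Icc (0 : ℝ) 1, ∀ x₀ : SpaceTimeIdx L M, imagTimeWeight β M *
      ∑ x ∈ (univ : Finset (Fin 2 → SpaceTimeIdx L M)).filter (fun x => x 0 = x₀),
        (1 + ((((x 1).2 - (x 0).2) 0).valMinAbs.natAbs : ℝ) + ((((x 1).2 - (x 0).2) 1).valMinAbs.natAbs : ℝ)) ^ j *
          ‖sectorisedKernel L M β (trivialMultiplier L M)
              (effAction ℂ (normalCovariance L M s₀ + ((t : ℂ)) • (normalCovariance L M s₁ - normalCovariance L M s₀))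
                (hubbardInteraction L M β U)) 2
              (![((0, σ), 0), ((0, σ), 1)] : Fin 2 → SectorLeg 1) x‖ ≤ Sp)
    {N' : ℕ} {B : ℝ} (hB1 : 1 ≤ B) (hB : ∀ l ≤ N', ∀ t, ‖iteratedDeriv l salmhoferCutoff t‖ ≤ B) (hN' : j + 4 ≤ N')
    {pj : ℕ → ℕ → ℝ} (hpj : ∀ m ≤ n, ∀ j' ≤ j + 2, ∀ q : Momentum, ‖iteratedFDeriv ℝ j' (evalM (klFlowPiece L M β U μ m)) q‖ ≤ pj m j')
    {d : ℝ} (hfit : ∀ (i : MatsubaraIdx M), i = ip ∨ i = im → ∀ (j' : ℕ), 1 ≤ j' → j' ≤ j + 2 →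
      4 + ∑ m ∈ range n, pj m j' + pj n j' ≤ d * (6 / max |matsubaraFreq β M i| (Λ / 2)) ^ (j' - 1))
    {J : ℝ}
    (hJ : ∀ (i : MatsubaraIdx M), i = ip ∨ i = im → ∀ k ≤ j + 2, (Real.pi / 2) ^ k * ∑ j' ∈ Finset.range (k + 1), (k.choose j' : ℝ) *
      (j' ! * ((2 * (β * (L : ℝ) ^ 2) * B * (2 / max |matsubaraFreq β M i| (Λ / 2)) ^ 2) * j' !) *
        (max d 1 * (6 / max |matsubaraFreq β M i| (Λ / 2))) ^ j') * pj n (k - j') ≤ J) (q : Momentum) :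
    ‖iteratedFDeriv ℝ j (evalM (symInterp L (fun kv : TorusSite 2 L => (∑ σ : Fin 2,
        ((selfEnergy L M β (effAction ℂ (normalCovariance L M s₁) (hubbardInteraction L M β U)) (ip, kv) σ -
            selfEnergy L M β (effAction ℂ (normalCovariance L M s₀) (hubbardInteraction L M β U)) (ip, kv) σ).re +
          (selfEnergy L M β (effAction ℂ (normalCovariance L M s₁) (hubbardInteraction L M β U)) (im, kv) σ -
            selfEnergy L M β (effAction ℂ (normalCovariance L M s₀) (hubbardInteraction L M β U)) (im, kv) σ).re)) / 4))) q‖ ≤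
      2 * (|β| * (L : ℝ) ^ 2) *
        (12 * (2 * (L : ℝ) ^ 2 * ((2 * B₁ + 1) * (β * (L : ℝ) ^ 2)) * (2 * β / Λ) *
            frameDist (klFlowFrameU L M β U μ (n + 1)) (klFlowFrameU L M β U μ n)) * (Np / (β * (L : ℝ) ^ 2) ^ 3) +
          2 * (21 * 3 ^ j * J) * (Sp / (β * (L : ℝ) ^ 2)) ^ 2) := by
  set W₁ := effAction ℂ (normalCovariance L M s₁) (hubbardInteraction L M β U) with hW₁
  set W₀ := effAction ℂ (normalCovariance L M s₀) (hubbardInteraction L M β U) with hW₀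
  set Bd : ℝ := 2 * (|β| * (L : ℝ) ^ 2) *
    (12 * (2 * (L : ℝ) ^ 2 * ((2 * B₁ + 1) * (β * (L : ℝ) ^ 2)) * (2 * β / Λ) *
        frameDist (klFlowFrameU L M β U μ (n + 1)) (klFlowFrameU L M β U μ n)) * (Np / (β * (L : ℝ) ^ 2) ^ 3) +
      2 * (21 * 3 ^ j * J) * (Sp / (β * (L : ℝ) ^ 2)) ^ 2) with hBd
  -- door (B) on the flow with position inputs, at the two reading indices and each spin
  have hdoor : ∀ (i : MatsubaraIdx M), i = ip ∨ i = im → ∀ σ : Fin 2,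
      ∑ x : TorusSite 2 L, (1 + ((x 0).valMinAbs.natAbs : ℝ) + ((x 1).valMinAbs.natAbs : ℝ)) ^ j *
        ‖torusFourierInv (fun kv : TorusSite 2 L => selfEnergy L M β W₁ (i, kv) σ - selfEnergy L M β W₀ (i, kv) σ) x‖ ≤ Bd :=
    fun i hi σ => moment_selfEnergy_flowStep_sub_le_of_position hB' hβ hΛ μ U n hs₀ hs₁ i σ j hZ (fun t ht τ c => hNp σ τ c t ht)
      (hSp σ) hB1 hB hN' hpj (hfit i hi) (hJ i hi)
  -- the reading step
  have hread := norm_iteratedFDeriv_evalM_symInterp_locReAvg_le (L := L)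
    (fun σ (kv : TorusSite 2 L) => selfEnergy L M β W₁ (ip, kv) σ - selfEnergy L M β W₀ (ip, kv) σ)
    (fun σ (kv : TorusSite 2 L) => selfEnergy L M β W₁ (im, kv) σ - selfEnergy L M β W₀ (im, kv) σ) j q
  refine hread.trans ?_
  calc (∑ σ : Fin 2, ((∑ x : TorusSite 2 L, (1 + ((x 0).valMinAbs.natAbs : ℝ) + ((x 1).valMinAbs.natAbs : ℝ)) ^ j *
          ‖torusFourierInv (fun kv : TorusSite 2 L => selfEnergy L M β W₁ (ip, kv) σ - selfEnergy L M β W₀ (ip, kv) σ) x‖) +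
        (∑ x : TorusSite 2 L, (1 + ((x 0).valMinAbs.natAbs : ℝ) + ((x 1).valMinAbs.natAbs : ℝ)) ^ j *
          ‖torusFourierInv (fun kv : TorusSite 2 L => selfEnergy L M β W₁ (im, kv) σ - selfEnergy L M β W₀ (im, kv) σ) x‖))) / 4
      ≤ (∑ _σ : Fin 2, (Bd + Bd)) / 4 :=
        div_le_div_of_nonneg_right (sum_le_sum fun σ _ => add_le_add (hdoor ip (Or.inl rfl) σ) (hdoor im (Or.inr rfl) σ)) (by norm_num)
    _ = Bd := by rw [sum_const, card_univ, Fintype.card_fin]; ring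

end Summit.HubbardSuperconductivity.HubbardSuperconductivity.Theorems.EngineV8

end
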